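import Summits.Ventures.HSemireg.WedgeHankelRecurrenceGaussChebyshevTAntiFixedPointIdeal

/-!
# Venture HSemireg — **THE MIXED-LEVEL IDEAL `(C_m − 2, C_n + 2)` IN `R[X]` FOR EVERY COMMUTATIVE RING: `= (C_g + 2)` IF `m ∕ g` IS EVEN, `= (4, C_g − 2) = (4, C_g + 2)` IF `m ∕ g` IS ODD** (`g = gcd(m,n)`;
# the points `t + t⁻¹` with `t^m = 1` against those with `t^n = −1`) — completing, with N489 (`−2 ∕ −2`), N491 and N494 (`+2 ∕ +2`), the `2 × 2` table of level-`±2` ideals of the Vieta–Lucas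
# polynomials; integer readings **`gcd(V_m − 2, V_n + 2) = |V_g + 2|`** resp. **`= gcd(4, V_g − 2)`** for `V_n(P, 1)`.  Same faithfully flat descent (N494 `quadExt_ideal_eq_of_map_eq`): with `y = τ^g`,
# for `m ∕ g` even put `z = −y`, so `τ^m − 1 = z^{m'} − 1`, `τ^n + 1 = −(z^{n'} − 1)` and N489 applies; for `m ∕ g` odd, `gcd(m', 2n') = 1` makes `y^{n'} + 1` coprime to `Σ_{i<m'} y^i`, and
# `y^{n'} + 1 = 2 + (y − 1)c` gives `((y^{n'}+1)², (y−1)²) = (4, (y−1)²)`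

HONEST FRAMING. Part of the Lean index of the computation cell `pub-hsemireg` (seat p10 gen 48, Sunday typer «UNIFORM-IN-n»).  Commutative algebra of polynomial ideals only; no variety, no cohomology
theory, no sheaf, no Ext group and no semiregularity map is constructed here; nothing here says that HC / HC_CM / HC_AV holds; no Literature fact (unproved `Prop`) is declared or used.  Custodian
versions as in `WedgeHankelSiegelIdeal` (1/3).
SOURCES (cited).  R. Lidl, G. L. Mullen, G. Turnwald, *Dickson Polynomials* (1993), Ch. 3; H. Matsumura, *Commutative Ring Theory* (1986), Thm 7.5; W. L. McDaniel, Fibonacci Quart. 29 (1991) 24–29.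
PROOF TYPED HERE.  N494 `quadExt_ideal_eq_of_map_eq`, `span_pair_sq_eq_of_eq_two_add`; N489 `quadExt_chebyshevC_sub_two`, `span_pair_pow_sub_one_sq`, `geom_sum_isCoprime`, `geom_sum_range_add`,
`pow_mul_sub_one_eq_mul_geom_sum`; N491 `quadExt_chebyshevC_add_two`; N457 `span_pair_mul_right_of_isCoprime`; Mathlib `sub_one_dvd_pow_sub_one`, `Even.neg_pow ∕ Odd.neg_pow`, `IsCoprime.of_mul_left_left`,
`Ideal.span_pair_add_right_mul`, `Ideal.span_singleton_mul_left_unit`; N476 `int_gcd_eq_natAbs_of_span_pair_eq`, `int_gcd_eq_of_span_pair_eq`, `lucasV_one_eq_chebyshevC_eval`.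
DEDUP DISCLOSURE (`rg -n 'chebyshevC_sub_two_add_two_span_pair|span_pair_four_chebyshevC|lucasV_one_sub_two_add_two_gcd' Summits Literature HarnessLib`, 2026-09-04): 0 hits for the 5 names below.

WHAT IS IN THE TREE.  N457, N476, N489, N491, N494.
THIS FILE (namespace `Summit.Ventures.HSemireg.Wedge.HankelOuter` continued; CHAINED on N496; 0 definitions):
* §1262 **`chebyshevC_sub_two_add_two_span_pair_even`**, **`chebyshevC_sub_two_add_two_span_pair_odd`**, `span_pair_four_chebyshevC_sub_two` (`(4, C_g − 2) = (4, C_g + 2)`),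
  **`lucasV_one_sub_two_add_two_gcd_even`**, **`lucasV_one_sub_two_add_two_gcd_odd`**.
CAVEATS.  Nothing Ext-side.  New names only.
-/

open Module Polynomial
open scoped Matrix Polynomial

namespace Summit.Ventures.HSemireg.Wedge.HankelOuter

/-! ## §1262. `(C_m − 2, C_n + 2)` -/

/-- **`(C_m − 2, C_n + 2) = (C_{gcd(m,n)} + 2)` in `R[X]` for every commutative ring `R`, when `m ∕ gcd(m,n)` is even.** [Lidl–Mullen–Turnwald Ch. 3; this file, §1262] -/
theorem chebyshevC_sub_two_add_two_span_pair_even {R : Type*} [CommRing R] {m n : ℕ} (hm : Even (m / Nat.gcd m n)) :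
    Ideal.span {Polynomial.Chebyshev.C R (m : ℤ) - 2, Polynomial.Chebyshev.C R (n : ℤ) + 2} = Ideal.span {Polynomial.Chebyshev.C R (Nat.gcd m n : ℤ) + 2} := by
  obtain ⟨g, hgdef⟩ : ∃ g, Nat.gcd m n = g := ⟨_, rfl⟩
  rw [hgdef] at hm ⊢
  rcases Nat.eq_zero_or_pos g with h0 | hg
  · subst h0
    obtain ⟨rfl, rfl⟩ := Nat.gcd_eq_zero_iff.1 hgdef
    rw [Nat.cast_zero, Polynomial.Chebyshev.C_zero, sub_self, Ideal.span_insert_zero]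
  obtain ⟨m', hm'⟩ : g ∣ m := hgdef ▸ Nat.gcd_dvd_left m n
  obtain ⟨n', hn'⟩ : g ∣ n := hgdef ▸ Nat.gcd_dvd_right m n
  have hc := Nat.coprime_div_gcd_div_gcd (hgdef.symm ▸ hg)
  rw [hgdef] at hc
  subst hm' hn'
  rw [Nat.mul_div_cancel_left _ hg] at hm hc
  rw [Nat.mul_div_cancel_left _ hg] at hc
  have hn : Odd n' := by
    rcases Nat.even_or_odd n' with h | h
    · exfalso
      have h2 : 2 ∣ Nat.gcd m' n' := Nat.dvd_gcd (even_iff_two_dvd.1 hm) (even_iff_two_dvd.1 h)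
      rw [hc] at h2; exact absurd h2 (by norm_num)
    · exact h
  apply quadExt_ideal_eq_of_map_eq
  intro B _ _ _ τ σ hmul hadd
  have hσ : IsUnit σ := IsUnit.of_mul_eq_one τ (by rw [mul_comm]; exact hmul)
  -- in `B`, with `z = −τ^g`: `((z^{m'} − 1)², (z^{n'} − 1)²) = ((z − 1)²)`
  have hsq : Ideal.span {(τ ^ (g * m') - 1) ^ 2, (τ ^ (g * n') + 1) ^ 2} = Ideal.span {((τ ^ g + 1) ^ 2 : B)} := by
    have h := span_pair_pow_sub_one_sq (-(τ ^ g)) m' n'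
    rwa [hc.gcd_eq_one, pow_one, hm.neg_pow, hn.neg_pow, ← pow_mul, ← pow_mul, show (-(τ ^ (g * n')) - 1) ^ 2 = (τ ^ (g * n') + 1) ^ 2 by ring,
      show (-(τ ^ g) - 1) ^ 2 = (τ ^ g + 1) ^ 2 by ring] at h
  rw [Ideal.map_span, Ideal.map_span, Set.image_pair, Set.image_singleton, quadExt_chebyshevC_sub_two hmul hadd, quadExt_chebyshevC_add_two hmul hadd, quadExt_chebyshevC_add_two hmul hadd,
    Ideal.span_insert, Ideal.span_singleton_mul_left_unit (hσ.pow _), Ideal.span_singleton_mul_left_unit (hσ.pow _), Ideal.span_singleton_mul_left_unit (hσ.pow _), ← Ideal.span_insert, hsq]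

/-- **`(C_m − 2, C_n + 2) = (4, C_{gcd(m,n)} − 2)` in `R[X]` for every commutative ring `R`, when `m ∕ gcd(m,n)` is odd.** [Lidl–Mullen–Turnwald Ch. 3; this file, §1262] -/
theorem chebyshevC_sub_two_add_two_span_pair_odd {R : Type*} [CommRing R] {m n : ℕ} (hm : Odd (m / Nat.gcd m n)) :
    Ideal.span {Polynomial.Chebyshev.C R (m : ℤ) - 2, Polynomial.Chebyshev.C R (n : ℤ) + 2} = Ideal.span {4, Polynomial.Chebyshev.C R (Nat.gcd m n : ℤ) - 2} := by
  obtain ⟨g, hgdef⟩ : ∃ g, Nat.gcd m n = g := ⟨_, rfl⟩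
  rw [hgdef] at hm ⊢
  have hg : 0 < g := by
    rcases Nat.eq_zero_or_pos g with h0 | h0
    · rw [h0, Nat.div_zero] at hm; exact absurd hm (by decide)
    · exact h0
  obtain ⟨m', hm'⟩ : g ∣ m := hgdef ▸ Nat.gcd_dvd_left m n
  obtain ⟨n', hn'⟩ : g ∣ n := hgdef ▸ Nat.gcd_dvd_right m n
  have hc := Nat.coprime_div_gcd_div_gcd (hgdef.symm ▸ hg)
  rw [hgdef] at hc
  subst hm' hn'
  rw [Nat.mul_div_cancel_left _ hg] at hm hc
  rw [Nat.mul_div_cancel_left _ hg] at hc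
  have hc2 : Nat.Coprime (n' + n') m' := by
    rw [← two_mul]; exact Nat.coprime_mul_iff_left.2 ⟨Nat.coprime_two_left.2 hm, hc.symm⟩
  apply quadExt_ideal_eq_of_map_eq
  intro B _ _ _ τ σ hmul hadd
  have hσ : IsUnit σ := IsUnit.of_mul_eq_one τ (by rw [mul_comm]; exact hmul)
  -- `τ^{g m'} − 1 = (τ^g − 1) G_{m'}(τ^g)`, and `τ^{g n'} + 1` is coprime to `G_{m'}(τ^g)`
  have hGm : τ ^ (g * m') - 1 = (τ ^ g - 1) * ∑ i ∈ Finset.range m', (τ ^ g) ^ i := pow_mul_sub_one_eq_mul_geom_sum τ g m'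
  have hcop : IsCoprime ((∑ i ∈ Finset.range m', (τ ^ g) ^ i) ^ 2) ((τ ^ (g * n') + 1) ^ 2) := by
    have h := geom_sum_isCoprime (τ ^ g) hc2
    rw [geom_sum_range_add, ← one_add_mul, ← pow_mul, add_comm (1 : B)] at h
    exact (h.of_mul_left_left.symm).pow
  obtain ⟨c, hc'⟩ : τ ^ g - 1 ∣ τ ^ (g * n') - 1 := by rw [pow_mul]; exact sub_one_dvd_pow_sub_one _ _
  have hA : τ ^ (g * n') + 1 = 2 + (τ ^ g - 1) * c := by linear_combination hc'
  have hR : Ideal.span {(4 : B), σ ^ g * (τ ^ g - 1) ^ 2} = Ideal.span {4, (τ ^ g - 1) ^ 2} := by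
    rw [Ideal.span_pair_comm, Ideal.span_insert, Ideal.span_singleton_mul_left_unit (hσ.pow _), ← Ideal.span_insert, Ideal.span_pair_comm]
  rw [Ideal.map_span, Ideal.map_span, Set.image_pair, Set.image_pair, quadExt_chebyshevC_sub_two hmul hadd, quadExt_chebyshevC_add_two hmul hadd, quadExt_chebyshevC_sub_two hmul hadd, map_ofNat,
    Ideal.span_insert, Ideal.span_singleton_mul_left_unit (hσ.pow _), Ideal.span_singleton_mul_left_unit (hσ.pow _), ← Ideal.span_insert, hGm, mul_pow,
    span_pair_mul_right_of_isCoprime hcop, Ideal.span_pair_comm, span_pair_sq_eq_of_eq_two_add hA, hR]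

/-- `(4, C_g − 2) = (4, C_g + 2)`. [bookkeeping; this file, §1262] -/
theorem span_pair_four_chebyshevC_sub_two {R : Type*} [CommRing R] (k : ℤ) :
    Ideal.span {(4 : R[X]), Polynomial.Chebyshev.C R k - 2} = Ideal.span {4, Polynomial.Chebyshev.C R k + 2} := by
  rw [Ideal.span_pair_comm, show Polynomial.Chebyshev.C R k - 2 = (Polynomial.Chebyshev.C R k + 2) + 4 * (-1) by ring, Ideal.span_pair_add_right_mul, Ideal.span_pair_comm]

/-- **`gcd(V_m − 2, V_n + 2) = |V_{gcd(m,n)} + 2|`** for `V_n(P,1)` over `ℤ`, when `m ∕ gcd(m,n)` is even. [this file, §1262] -/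
theorem lucasV_one_sub_two_add_two_gcd_even {P : ℤ} {V : ℕ → ℤ} (hV0 : V 0 = 2) (hV1 : V 1 = P) (hV : ∀ n, V (n + 2) = P * V (n + 1) - V n) {m n : ℕ}
    (hm : Even (m / Nat.gcd m n)) : Int.gcd (V m - 2) (V n + 2) = (V (Nat.gcd m n) + 2).natAbs := by
  have hev1 : ∀ k : ℕ, Polynomial.evalRingHom P (Polynomial.Chebyshev.C ℤ (k : ℤ) - 2) = V k - 2 := fun k => by
    rw [map_sub, map_ofNat, Polynomial.coe_evalRingHom, lucasV_one_eq_chebyshevC_eval hV0 hV1 hV k]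
  have hev2 : ∀ k : ℕ, Polynomial.evalRingHom P (Polynomial.Chebyshev.C ℤ (k : ℤ) + 2) = V k + 2 := fun k => by
    rw [map_add, map_ofNat, Polynomial.coe_evalRingHom, lucasV_one_eq_chebyshevC_eval hV0 hV1 hV k]
  have h := congrArg (Ideal.map (Polynomial.evalRingHom P)) (chebyshevC_sub_two_add_two_span_pair_even (R := ℤ) (n := n) hm)
  rw [Ideal.map_span, Ideal.map_span, Set.image_pair, Set.image_singleton, hev1, hev2, hev2] at h
  exact int_gcd_eq_natAbs_of_span_pair_eq h

/-- **`gcd(V_m − 2, V_n + 2) = gcd(4, V_{gcd(m,n)} − 2)`** for `V_n(P,1)` over `ℤ`, when `m ∕ gcd(m,n)` is odd. [this file, §1262] -/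
theorem lucasV_one_sub_two_add_two_gcd_odd {P : ℤ} {V : ℕ → ℤ} (hV0 : V 0 = 2) (hV1 : V 1 = P) (hV : ∀ n, V (n + 2) = P * V (n + 1) - V n) {m n : ℕ}
    (hm : Odd (m / Nat.gcd m n)) : Int.gcd (V m - 2) (V n + 2) = Int.gcd 4 (V (Nat.gcd m n) - 2) := by
  have hev1 : ∀ k : ℕ, Polynomial.evalRingHom P (Polynomial.Chebyshev.C ℤ (k : ℤ) - 2) = V k - 2 := fun k => by
    rw [map_sub, map_ofNat, Polynomial.coe_evalRingHom, lucasV_one_eq_chebyshevC_eval hV0 hV1 hV k]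
  have hev2 : ∀ k : ℕ, Polynomial.evalRingHom P (Polynomial.Chebyshev.C ℤ (k : ℤ) + 2) = V k + 2 := fun k => by
    rw [map_add, map_ofNat, Polynomial.coe_evalRingHom, lucasV_one_eq_chebyshevC_eval hV0 hV1 hV k]
  have h := congrArg (Ideal.map (Polynomial.evalRingHom P)) (chebyshevC_sub_two_add_two_span_pair_odd (R := ℤ) (n := n) hm)
  rw [Ideal.map_span, Ideal.map_span, Set.image_pair, Set.image_pair, hev1, hev2, hev1, map_ofNat] at h
  exact int_gcd_eq_of_span_pair_eq h

end Summit.Ventures.HSemireg.Wedge.HankelOuter
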